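import Summits.BirchSwinnertonDyer.BirchSwinnertonDyer.Theorems.SignedLowerHalvesSprungLowerDivisibilityAtThreeKatoSporadicLedgerOrbit
import Summits.BirchSwinnertonDyer.BirchSwinnertonDyer.Theorems.SignedLowerHalvesSprungLowerDivisibilityAtThreeOffTLedgerDoor
import HarnessLib

/-!
# Crux `SprungLowerDivisibilityAtThree` (item stmt-BirchSwinnertonDyer-19875) / x8 crux `CyclotomicLowerPosLevelX8` (item 22901),
# line `chromatic-common-zeros`: the ledger at a POSITIVE-LEVEL CYCLOTOMIC prime `𝔭 = (Φ_{3^j}(1+T))` — such a prime is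
# `ι`-FIXED, so the orbit window collapses to `m(𝔭) ≤ 2·k(𝔭)` and a cyclotomic common zero (= an exceptional twisted zero
# `L(E, χ, 1) = 0`, conductor `3^{j+1}`) forces a POSITIVE zeta index `k(𝔭) ≥ 1` — modulo the cokernel bound F-α at `𝔭`

Cell `bsd-ssimc` (host), width seat `cruxlead-stmt-BirchSwinnertonDyer-19875-w3` (gen 6); `--supports` stmt-BirchSwinnertonDyer-22901
`--as helper`; theorems only; closes NO item. Companion of `…KatoSporadicLedgerOrbit` (p650723: the orbit window with Kato's Thm. 13.4
consumed, print-keyed, w2 g7 p649616) and `…OffTLedgerDoor` (p651820). HONEST FRAMING: structure of the open stub S4b-cyc's currency;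
CONDITIONAL on `h134C` (Kato 2004 Thm. 13.4, print-exact key), `hSerre`, an auxiliary `γ⁻¹`-keyed fine datum `FB`, and the DISPLAYED
cokernel bound F-α at `𝔭`; S4b-cyc / 22901, K1, leaf X8 and BSD are NOT proved by anything here.

* `comap_invol_eq_self_of_cyclotomic_comp_mem`: a height-one `𝔭 ∋ Φ_{3^j}(1+T)` (`j ≥ 1`) of `Λ = ℤ₃⟦T⟧` satisfies `ι𝔭 = 𝔭`
  (`𝔭 = (Φ)` and `Φ(T^ι) ∈ (Φ)`: w3 g5's `ChromaticIota.subst_mem_span_cyclotomic_of_mem`, p642657) — the keying caveat of STUB-PLAN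
  §0bis is VOID at these primes (typed = print).
* `ClassX8.min_lengthAt_quotient_span_le_two_mul_zeta_of_cyclotomic`: at such `𝔭`, `min(ℓ_𝔭 Λ/(Gs), ℓ_𝔭 Λ/(Gf)) ≤ 2·ℓ_𝔭(I.H ⧸ Cs.Z)`
  modulo F-α at `𝔭` — the zeta index carries at least HALF of a cyclotomic common zero.
* `ClassX8.one_le_zeta_of_cyclotomic_commonZero`: `Gs, Gf ∈ 𝔭 ⟹ 1 ≤ ℓ_𝔭(I.H ⧸ Cs.Z)` modulo F-α at `𝔭` — at every exceptional-zero
  prime dividing both normalised colours, Kato's zeta module `Z` is a PROPER submodule of `𝐇¹` locally (the Euler system «sees» the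
  exceptional zero), which is the ⊇ direction's shadow of S4b-cyc; the stub itself (`k ≤ x` there) stays OPEN.

References: [Kato2004Asterisque] Thm. 12.6 (p. 222), Thm. 13.4 (p. 226), Conj. 12.10 (p. 224); [Sprung2012] §7.1, Prop. 7.19, Main Conj. 7.21
(p. 1505); [Sprung2017] §3.4 Prop. 3.14 (`ι` on cyclotomic factors); [Rohrlich1984]; tree: `…KatoSporadicLedgerOrbit` (p650723),
`…KatoSporadicLedgerKato` (p649616), `…OffTLedgerDoor` (p651820), `…IotaCyclotomicPairing` (p642657), `…CyclotomicCertDoor` (`prime_cyclotomic_comp`).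
-/

set_option linter.dupNamespace false
set_option autoImplicit false

noncomputable section

open scoped Classical NumberField MatrixGroups ModularForm Polynomial

open NumberField IsDedekindDomain CongruenceSubgroup WeierstrassCurve Field
  Literature.NumberTheory.EllipticCurves Literature.NumberTheory.EllipticCurves.ModularForms
  Literature.NumberTheory.EllipticCurves.ZpExtension Literature.NumberTheory.EllipticCurves.Sprung2017
  Literature.NumberTheory.EllipticCurves.Sprung2012 Literature.NumberTheory.EllipticCurves.Rank1Residual
  Literature.NumberTheory.EllipticCurves.IwasawaAlgebra Literature.NumberTheory.EllipticCurves.Kato2004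
  Literature.NumberTheory.EllipticCurves.Module
  Summit.BirchSwinnertonDyer.BirchSwinnertonDyer.Theorems
  Summit.BirchSwinnertonDyer.BirchSwinnertonDyer.Theorems.SmallImageSignedMuDefect
  Summit.BirchSwinnertonDyer.Rank1Residual.Supersingular

namespace Summit.BirchSwinnertonDyer.BirchSwinnertonDyer.Theorems.ChromaticCommonZeros

/-! ### §1 Positive-level cyclotomic primes are `ι`-fixed -/

/-- **`ι𝔭 = 𝔭` for a height-one `𝔭 ∋ Φ_{3^j}(1+T)`, `j ≥ 1`** (`𝔭 = (Φ_{3^j}(1+T))` is principal prime; `Φ(T^ι) ∈ (Φ)` and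
`ι ∘ ι = id`). [cite: Sprung2017, §3.4 Prop. 3.14] [cite: GreenbergLNM1716, §1] [cite: Washington1997, §7.1 and §13.2] -/
theorem comap_invol_eq_self_of_cyclotomic_comp_mem (𝔭 : PrimeSpectrum (IwasawaAlgebra 3)) (h𝔭 : 𝔭.asIdeal.height = 1)
    {j : ℕ} (hj : 1 ≤ j)
    (hΦ : ((((Polynomial.cyclotomic (3 ^ j) ℤ).comp (Polynomial.X + 1)).map (Int.castRingHom ℤ_[3]) :
      Polynomial ℤ_[3]) : PowerSeries ℤ_[3]) ∈ 𝔭.asIdeal) :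
    PrimeSpectrum.comap (invol 3).toRingHom 𝔭 = 𝔭 := by
  obtain ⟨k, rfl⟩ : ∃ k, j = k + 1 := ⟨j - 1, by omega⟩
  have heq := Ideal.eq_span_singleton_of_height_eq_one h𝔭 hΦ (prime_cyclotomic_comp (p := 3) k)
  have hstab : ∀ x ∈ 𝔭.asIdeal, invol 3 x ∈ 𝔭.asIdeal := by
    intro x hx
    rw [heq] at hx ⊢
    rw [SignedKatoOffTwo.Invol.invol_eq_subst_invOnePlusSubOne]
    exact ChromaticIota.subst_mem_span_cyclotomic_of_mem k hx
  apply PrimeSpectrum.ext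
  ext x
  rw [PrimeSpectrum.comap_asIdeal, Ideal.mem_comap]
  constructor
  · intro hx
    have h := hstab _ hx
    change invol 3 (invol 3 x) ∈ 𝔭.asIdeal at h
    rwa [invol_invol] at h
  · intro hx
    exact hstab x hx

/-! ### §2 The ledger at a positive-level cyclotomic prime on class X8 -/

section X8

variable (W : WeierstrassCurve ℚ) [W.IsElliptic] [W.IsGloballyMinimal] (p : ℕ) [Fact p.Prime]
  [ContinuousSMul ℤ_[p] (W.tateModule p)] [Module.Free ℤ_[p] (W.tateModule p)]
  [Module.Finite ℤ_[p] (W.tateModule p)]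
  {N : ℕ} [NeZero N] {f : CuspForm (Gamma0 N) 2} {ϖ : ℚ} {κ : ZpExtension ℚ p} {γ : absoluteGaloisGroup ℚ}
  {E : Type} [Field E] [Algebra ℚ E] {ι : AlgebraicClosure ℚ →ₐ[ℚ] AlgebraicClosure E}
  {g : absoluteGaloisGroup E} {c : ℕ → localPoints W E} {I : IwasawaH1Data W p κ γ}

/-- **At a positive-level cyclotomic prime the orbit window is `m ≤ 2k`.** For the joint ♯/♭ package of an X8 pair, its newform with
period ratio `ϖ`, Sprung pair and normalised `Gs, Gf`, a `γ`-keyed `Y` and `γ⁻¹`-keyed `FB`, and a height-one `𝔭 ∋ Φ_{p^j}(1+T)`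
(`j ≥ 1`; then `p ∉ 𝔭` and `ι𝔭 = 𝔭`), DISPLAYED the cokernel bound F-α at `𝔭`: `min(ℓ_𝔭 Λ/(Gs), ℓ_𝔭 Λ/(Gf)) ≤ 2·ℓ_𝔭(I.H ⧸ Cs.Z)`.
CONDITIONAL on `h134C`, `hSerre`. [cite: Kato2004Asterisque, Thm. 13.4 (p. 226)] [cite: Sprung2012, §7.1, Prop. 7.19 (p. 1505)]
[cite: Sprung2017, §3.4 Prop. 3.14] -/
theorem ClassX8.min_lengthAt_quotient_span_le_two_mul_zeta_of_cyclotomic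
    (h134C : thm13_4_lengthAt_fineSelmerDualContra_le_of_isEulerSystemClass)
    (hSerre : serre_adicImage_contains_congruenceSubgroup) (hX : ClassX8 W p)
    (Cs : SharpFlatColemanKatoData W p f ϖ κ γ ι (W.frobeniusTrace p) g c Chroma.sharp I)
    (Cf : SharpFlatColemanKatoData W p f ϖ κ γ ι (W.frobeniusTrace p) g c Chroma.flat I) (hZ : Cs.Z = Cf.Z)
    (hκ : κ.IsCyclotomic) (hγ : κ.IsTopGenerator γ) {Lsharp Lflat Gs Gf : IwasawaAlgebra p} (hf : IsNewformOf W f)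
    (hϖ : (ϖ : ℝ) * W.realPeriodRat = plusPeriod f) (hSP : IsSprungPair f p (W.frobeniusTrace p) Lsharp Lflat)
    (hGs : iwasawaToPowerSeries p Gs =
      PowerSeries.C ((ϖ : ℚ) : ℚ_[p]) * iwasawaToPowerSeries p (chromaticL Chroma.sharp Lsharp Lflat))
    (hGf : iwasawaToPowerSeries p Gf =
      PowerSeries.C ((ϖ : ℚ) : ℚ_[p]) * iwasawaToPowerSeries p (chromaticL Chroma.flat Lsharp Lflat))
    (Y : W.FineSelmerDualData κ γ) (FB : W.FineSelmerDualData κ γ⁻¹)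
    (𝔭 : PrimeSpectrum (IwasawaAlgebra p)) (h𝔭 : 𝔭.asIdeal.height = 1) {j : ℕ} (hj : 1 ≤ j)
    (hΦ : ((((Polynomial.cyclotomic (p ^ j) ℤ).comp (Polynomial.X + 1)).map (Int.castRingHom ℤ_[p]) :
      Polynomial ℤ_[p]) : PowerSeries ℤ_[p]) ∈ 𝔭.asIdeal)
    (hFα : min (Module.lengthAt (IwasawaAlgebra p) (IwasawaAlgebra p ⧸ LinearMap.range Cs.colMap) 𝔭)
        (Module.lengthAt (IwasawaAlgebra p) (IwasawaAlgebra p ⧸ LinearMap.range Cf.colMap) 𝔭) ≤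
      Module.lengthAt (IwasawaAlgebra p) Y.X 𝔭) :
    min (Module.lengthAt (IwasawaAlgebra p) (IwasawaAlgebra p ⧸ Ideal.span {Gs}) 𝔭)
        (Module.lengthAt (IwasawaAlgebra p) (IwasawaAlgebra p ⧸ Ideal.span {Gf}) 𝔭) ≤
      2 * Module.lengthAt (IwasawaAlgebra p) (I.H ⧸ Cs.Z) 𝔭 := by
  have hp3 : p = 3 := hX.1
  subst hp3
  have hp𝔭 : ((3 : ℕ) : IwasawaAlgebra 3) ∉ 𝔭.asIdeal := natCast_not_mem_of_cyclotomic_comp_mem 𝔭 h𝔭 hj hΦ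
  have hfix := comap_invol_eq_self_of_cyclotomic_comp_mem 𝔭 h𝔭 hj hΦ
  obtain ⟨hs0, hf0⟩ :=
    ChromaticBothColours.ClassX8.sharp_ne_zero_and_flat_ne_zero W 3 hX N inferInstance f Lsharp Lflat hf hSP
  have hϖ0 : ϖ ≠ 0 := by
    rintro rfl
    have hpos : 0 < plusPeriod f := IsNewform0.plusPeriod_pos_holds hf.1 hf.coeffField_eq_bot
    rw [Rat.cast_zero, zero_mul] at hϖ
    exact hpos.ne hϖ
  have hs : chromaticL Chroma.sharp Lsharp Lflat ≠ 0 := by rwa [chromaticL_sharp]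
  have hfl : chromaticL Chroma.flat Lsharp Lflat ≠ 0 := by rwa [chromaticL_flat]
  have hGs0 : Gs ≠ 0 := by
    intro h0
    rw [h0, map_zero, eq_comm, mul_eq_zero] at hGs
    rcases hGs with hC | hL
    · have h1 : ((ϖ : ℚ) : ℚ_[3]) = 0 := by simpa using congrArg PowerSeries.constantCoeff hC
      exact hϖ0 (by exact_mod_cast h1)
    · exact hs (iwasawaToPowerSeries_injective 3 (by rw [hL, map_zero]))
  have hw := min_lengthAt_quotient_span_le_zeta_add_zeta_comap_invol_of_thm13_4 W 3 h134C hSerre Cs Cf hZ (by decide) hκ hγ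
    (ClassX8.not_hasCM W 3 hX) (ClassX8.irr' W 3 hX) hSP hs hfl hGs hGf hGs0 Y FB 𝔭 h𝔭 hp𝔭 hFα
  rwa [hfix, ← two_mul] at hw

/-- **A cyclotomic common zero of positive level forces a POSITIVE zeta index there** (modulo F-α at `𝔭`, `h134C`, `hSerre`, `FB`):
in the situation above, `Gs, Gf ∈ 𝔭 ⟹ 1 ≤ ℓ_𝔭(I.H ⧸ Cs.Z)`. At an exceptional-zero prime `(Φ_{3^j}(1+T))` dividing both normalised
colours, Kato's zeta module is NOT all of `𝐇¹` locally. [cite: Kato2004Asterisque, Thm. 12.6 (p. 222), Thm. 13.4 (p. 226)]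
[cite: Sprung2012, Prop. 7.19, Main Conj. 7.21 (p. 1505)] [cite: Rohrlich1984] -/
theorem ClassX8.one_le_zeta_of_cyclotomic_commonZero
    (h134C : thm13_4_lengthAt_fineSelmerDualContra_le_of_isEulerSystemClass)
    (hSerre : serre_adicImage_contains_congruenceSubgroup) (hX : ClassX8 W p)
    (Cs : SharpFlatColemanKatoData W p f ϖ κ γ ι (W.frobeniusTrace p) g c Chroma.sharp I)
    (Cf : SharpFlatColemanKatoData W p f ϖ κ γ ι (W.frobeniusTrace p) g c Chroma.flat I) (hZ : Cs.Z = Cf.Z)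
    (hκ : κ.IsCyclotomic) (hγ : κ.IsTopGenerator γ) {Lsharp Lflat Gs Gf : IwasawaAlgebra p} (hf : IsNewformOf W f)
    (hϖ : (ϖ : ℝ) * W.realPeriodRat = plusPeriod f) (hSP : IsSprungPair f p (W.frobeniusTrace p) Lsharp Lflat)
    (hGs : iwasawaToPowerSeries p Gs =
      PowerSeries.C ((ϖ : ℚ) : ℚ_[p]) * iwasawaToPowerSeries p (chromaticL Chroma.sharp Lsharp Lflat))
    (hGf : iwasawaToPowerSeries p Gf =
      PowerSeries.C ((ϖ : ℚ) : ℚ_[p]) * iwasawaToPowerSeries p (chromaticL Chroma.flat Lsharp Lflat))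
    (Y : W.FineSelmerDualData κ γ) (FB : W.FineSelmerDualData κ γ⁻¹)
    (𝔭 : PrimeSpectrum (IwasawaAlgebra p)) (h𝔭 : 𝔭.asIdeal.height = 1) {j : ℕ} (hj : 1 ≤ j)
    (hΦ : ((((Polynomial.cyclotomic (p ^ j) ℤ).comp (Polynomial.X + 1)).map (Int.castRingHom ℤ_[p]) :
      Polynomial ℤ_[p]) : PowerSeries ℤ_[p]) ∈ 𝔭.asIdeal)
    (hFα : min (Module.lengthAt (IwasawaAlgebra p) (IwasawaAlgebra p ⧸ LinearMap.range Cs.colMap) 𝔭)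
        (Module.lengthAt (IwasawaAlgebra p) (IwasawaAlgebra p ⧸ LinearMap.range Cf.colMap) 𝔭) ≤
      Module.lengthAt (IwasawaAlgebra p) Y.X 𝔭)
    (hGs𝔭 : Gs ∈ 𝔭.asIdeal) (hGf𝔭 : Gf ∈ 𝔭.asIdeal) :
    1 ≤ Module.lengthAt (IwasawaAlgebra p) (I.H ⧸ Cs.Z) 𝔭 := by
  have hp3 : p = 3 := hX.1
  subst hp3
  have hp𝔭 : ((3 : ℕ) : IwasawaAlgebra 3) ∉ 𝔭.asIdeal := natCast_not_mem_of_cyclotomic_comp_mem 𝔭 h𝔭 hj hΦ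
  have hfix := comap_invol_eq_self_of_cyclotomic_comp_mem 𝔭 h𝔭 hj hΦ
  have h := ClassX8.one_le_zeta_add_zeta_comap_invol_of_commonZero W 3 h134C hSerre hX Cs Cf hZ hκ hγ hf hϖ hSP hGs hGf Y FB
    𝔭 h𝔭 hp𝔭 hFα hGs𝔭 hGf𝔭
  rw [hfix] at h
  -- `1 ≤ k + k ⟹ 1 ≤ k` in `ℕ∞`
  by_contra hk
  rw [not_le, Order.lt_one_iff] at hk
  rw [hk, add_zero] at h
  exact absurd h (by norm_num)

end X8

end Summit.BirchSwinnertonDyer.BirchSwinnertonDyer.Theorems.ChromaticCommonZeros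

end
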